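import Literature.NumberTheory.LFunctions.Zhang2022.Section7cStatements
import Literature.NumberTheory.LFunctions.Zhang2022.Section7XiZeroMajorants
import Literature.NumberTheory.LFunctions.Zhang2022.SkeletonWindowPowers
import HarnessLib

/-!
# Zhang (2022) §7, proof of Proposition 7.1 (b): auxiliary bounds for the tail `l > P²` of `𝔰`

Cell `siegel-zhang` (D-0069 width campaign), layer L2; auxiliary to `Section7TailP2`, which
discharges `Section7cStatements.Step7bTruncP2` (DAG node `Z22:(7.14)` lead-in, [Z22 p.38, tex
L2008]: "By Lemma 5.3, for `dhr < P₁`, the terms in `𝔰(r,h,d;θ)` with `l > P²` make a negligible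
error"). Y. Zhang, arXiv:2211.02515v1 [Zhang2022LandauSiegel], an unrefereed manuscript under
adjudication; nothing here concerns its Theorems 1–2. Contents (parameters `𝓛 = log D`,
`P = e^{𝓛⁹}`, `P₁ = P^{0.504}`, `t₀ = 𝓛⁵¹⁹`, `𝓛₂ = 𝓛⁴⁰⁰` of §2, §5):

* `termA`, `termB`: the two Gaussian-type terms of (5.9) at `y ≥ e^{0.49𝓛⁹}` are
  `≤ e^{−𝓛¹⁰−4log y−8𝓛⁹}`; `exp_049_le_and_t0_lt`: `e^{0.49𝓛⁹} ≤ P^{0.496}/2`, `t₀^{1.02} < e^{0.49𝓛⁹}`;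
* `norm_DeltaW_le_far`: from the Lemma-5.3 (ii) clause, `|Δ(y)| ≤ 2C e^{−𝓛¹⁰}e^{−8𝓛⁹}y⁻⁴` for
  `y ≥ e^{0.49𝓛⁹}`;
* `norm_conv_kappa_le`: `|(κ∗𝐚)(m)| ≤ B τ(m)⁴` when `|𝐚| ≤ B`;
* `card_primeWindow_le`: `#{p ∼ P} ≤ 3P`.

[cite: Zhang2022LandauSiegel, §7 p.38; §5 Lemma 5.3 (5.9)]
-/

noncomputable section

open Complex Real Finset

namespace Literature.NumberTheory.LFunctions.Zhang2022.Section7TailP2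

open Literature.NumberTheory.LFunctions.Zhang2022.Skeleton

/-! ### Elementary inequalities in `𝓛` -/

/-- `x^n ≤ e^{nx}` for `x ≥ 0`. [folklore] -/
private theorem pow_le_exp_mul {x : ℝ} (hx : 0 ≤ x) (n : ℕ) : x ^ n ≤ Real.exp (n * x) := by
  have h1 : x ≤ Real.exp x := by linarith [Real.add_one_le_exp x]
  calc x ^ n ≤ (Real.exp x) ^ n := pow_le_pow_left₀ hx h1 n
    _ = Real.exp (n * x) := by rw [← Real.exp_nat_mul]

/-- For `𝓛 ≥ 3`: `𝓛⁹ ≥ 6561·𝓛`. [folklore] -/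
private theorem ell9_ge {ℓ : ℝ} (hℓ : 3 ≤ ℓ) : 6561 * ℓ ≤ ℓ ^ 9 := by
  have h8 : (3 : ℝ) ^ 8 ≤ ℓ ^ 8 := pow_le_pow_left₀ (by norm_num) hℓ 8
  have : ℓ ^ 9 = ℓ ^ 8 * ℓ := by ring
  rw [this]; nlinarith

/-- **Term A.** For `𝓛 ≥ 3` and `u ≥ 0.49𝓛⁹`: `(𝓛⁴⁰⁰u/100)² ≥ 𝓛¹⁰ + 4u + 8𝓛⁹` (used with
`u = log y`: `e^{−(𝓛₂ log y/100)²} ≤ e^{−𝓛¹⁰} y⁻⁴ P⁻⁸`). [folklore] -/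
private theorem termA {ℓ u : ℝ} (hℓ : 3 ≤ ℓ) (hu : 0.49 * ℓ ^ 9 ≤ u) :
    ℓ ^ 10 + 4 * u + 8 * ℓ ^ 9 ≤ ((1 : ℝ) / 100 * ℓ ^ 400 * u) ^ 2 := by
  have hℓ1 : (1 : ℝ) ≤ ℓ := by linarith
  have h9 := ell9_ge hℓ
  have hu13 : 13 ≤ u := by nlinarith
  have hℓ5 : 100 * ℓ ^ 5 ≤ ℓ ^ 400 := by
    have h395 : (100 : ℝ) ≤ ℓ ^ 395 :=
      le_trans (by norm_num) (le_trans (pow_le_pow_left₀ (by norm_num) hℓ 5)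
        (pow_le_pow_right₀ hℓ1 (by norm_num)))
    calc 100 * ℓ ^ 5 ≤ ℓ ^ 395 * ℓ ^ 5 := by
          exact mul_le_mul_of_nonneg_right h395 (by positivity)
      _ = ℓ ^ 400 := by rw [← pow_add]
  have hu0 : 0 ≤ u := by linarith
  have hmain : ℓ ^ 5 * u ≤ (1 : ℝ) / 100 * ℓ ^ 400 * u := by nlinarith
  have hsq : (ℓ ^ 5 * u) ^ 2 ≤ ((1 : ℝ) / 100 * ℓ ^ 400 * u) ^ 2 :=
    pow_le_pow_left₀ (by positivity) hmain 2
  have h10 : ℓ ^ 10 = (ℓ ^ 5) ^ 2 := by ring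
  have hℓ10 : 1 ≤ ℓ ^ 10 := one_le_pow₀ hℓ1
  have hℓ9' : ℓ ^ 9 ≤ ℓ ^ 10 := by
    calc ℓ ^ 9 = ℓ ^ 9 * 1 := (mul_one _).symm
      _ ≤ ℓ ^ 9 * ℓ := mul_le_mul_of_nonneg_left hℓ1 (by positivity)
      _ = ℓ ^ 10 := by ring
  calc ℓ ^ 10 + 4 * u + 8 * ℓ ^ 9 ≤ 13 * ℓ ^ 10 * u := by nlinarith
    _ ≤ ℓ ^ 10 * u ^ 2 := by nlinarith
    _ = (ℓ ^ 5 * u) ^ 2 := by ring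
    _ ≤ _ := hsq

/-- **Term B.** For `𝓛 ≥ 3` and `y ≥ e^{0.49𝓛⁹}`: `√y/𝓛⁴⁰⁰ ≥ 𝓛¹⁰ + 4 log y + 8𝓛⁹` (so that
`e^{−y^{0.99}/𝓛₂} ≤ e^{−√y/𝓛₂} ≤ e^{−𝓛¹⁰} y⁻⁴ P⁻⁸`). [folklore] -/
private theorem termB {ℓ y : ℝ} (hℓ : 3 ≤ ℓ) (hy : Real.exp (0.49 * ℓ ^ 9) ≤ y) :
    ℓ ^ 10 + 4 * Real.log y + 8 * ℓ ^ 9 ≤ Real.sqrt y / ℓ ^ 400 := by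
  have hℓ0 : (0 : ℝ) < ℓ := by linarith
  have hℓ1 : (1 : ℝ) ≤ ℓ := by linarith
  have hy0 : 0 < y := lt_of_lt_of_le (Real.exp_pos _) hy
  have hy1 : 1 ≤ y := le_trans (Real.one_le_exp (by positivity)) hy
  -- `w = y^{1/4} ≥ 25 𝓛^410`
  set w : ℝ := y ^ (1 / 4 : ℝ) with hw
  have hw0 : 0 < w := Real.rpow_pos_of_pos hy0 _
  have hw1 : 1 ≤ w := Real.one_le_rpow hy1 (by norm_num)
  have hlogw : Real.log y ≤ 4 * w := by
    have := Real.log_le_rpow_div hy0.le (show (0 : ℝ) < 1 / 4 by norm_num)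
    rw [← hw] at this; linarith
  have hsqrt : Real.sqrt y = w ^ 2 := by
    rw [Real.sqrt_eq_rpow, hw, ← Real.rpow_natCast, ← Real.rpow_mul hy0.le]; norm_num
  have hwlarge : 25 * ℓ ^ 410 ≤ w := by
    -- `(25 𝓛^410)^4 = 390625 𝓛^1640 ≤ e^{13 + 1640 𝓛} ≤ e^{0.49 𝓛⁹} ≤ y`, then take fourth roots
    have h9 := ell9_ge hℓ
    have hexp : (25 * ℓ ^ 410) ^ 4 ≤ y := by
      have h1 : (25 * ℓ ^ 410) ^ 4 = 390625 * ℓ ^ 1640 := by ring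
      have h2 : ℓ ^ 1640 ≤ Real.exp (1640 * ℓ) := by exact_mod_cast pow_le_exp_mul hℓ0.le 1640
      have h3 : (390625 : ℝ) ≤ Real.exp 13 := by
        have he : Real.exp 13 = Real.exp 1 ^ 13 := by rw [← Real.exp_nat_mul]; norm_num
        have h13 : (2.7182818283 : ℝ) ^ 13 ≤ Real.exp 1 ^ 13 :=
          pow_le_pow_left₀ (by norm_num) (le_of_lt Real.exp_one_gt_d9) 13
        rw [he]
        exact le_trans (by norm_num) h13
      calc (25 * ℓ ^ 410) ^ 4 = 390625 * ℓ ^ 1640 := h1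
        _ ≤ Real.exp 13 * Real.exp (1640 * ℓ) :=
            mul_le_mul h3 h2 (by positivity) (Real.exp_pos _).le
        _ = Real.exp (13 + 1640 * ℓ) := by rw [Real.exp_add]
        _ ≤ Real.exp (0.49 * ℓ ^ 9) := Real.exp_le_exp.mpr (by nlinarith)
        _ ≤ y := hy
    have hroot : ((25 * ℓ ^ 410) ^ 4) ^ (1 / 4 : ℝ) ≤ y ^ (1 / 4 : ℝ) :=
      Real.rpow_le_rpow (by positivity) hexp (by norm_num)
    rw [← Real.rpow_natCast, ← Real.rpow_mul (by positivity)] at hroot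
    norm_num at hroot
    rw [hw]; exact hroot
  rw [hsqrt, le_div_iff₀ (by positivity)]
  have hℓ9' : ℓ ^ 9 ≤ ℓ ^ 10 := by
    calc ℓ ^ 9 = ℓ ^ 9 * 1 := (mul_one _).symm
      _ ≤ ℓ ^ 9 * ℓ := mul_le_mul_of_nonneg_left hℓ1 (by positivity)
      _ = ℓ ^ 10 := by ring
  have h410 : ℓ ^ 10 * ℓ ^ 400 = ℓ ^ 410 := by rw [← pow_add]
  have h400le : ℓ ^ 400 ≤ ℓ ^ 410 := pow_le_pow_right₀ hℓ1 (by norm_num)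
  have hp400 : 0 ≤ ℓ ^ 400 := by positivity
  have hp410 : 0 ≤ ℓ ^ 410 := by positivity
  calc (ℓ ^ 10 + 4 * Real.log y + 8 * ℓ ^ 9) * ℓ ^ 400
      ≤ (9 * ℓ ^ 10 + 16 * w) * ℓ ^ 400 := by
        apply mul_le_mul_of_nonneg_right _ hp400; linarith
    _ = 9 * ℓ ^ 410 + 16 * w * ℓ ^ 400 := by rw [← h410]; ring
    _ ≤ 9 * (w * ℓ ^ 410) + 16 * w * ℓ ^ 410 := by
        have h1 : ℓ ^ 410 ≤ w * ℓ ^ 410 := le_mul_of_one_le_left hp410 hw1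
        have h2 : 16 * w * ℓ ^ 400 ≤ 16 * w * ℓ ^ 410 :=
          mul_le_mul_of_nonneg_left h400le (by positivity)
        linarith
    _ = w * (25 * ℓ ^ 410) := by ring
    _ ≤ w * w := mul_le_mul_of_nonneg_left hwlarge hw0.le
    _ = w ^ 2 := by ring

/-- Thresholds: for `𝓛 ≥ 3`, `e^{0.49𝓛⁹} ≤ P^{0.496}/2` and `t₀^{1.02} < e^{0.49𝓛⁹}` (`P = e^{𝓛⁹}`,
`t₀ = 𝓛⁵¹⁹ ≤ e^{519𝓛}`). [cite: Zhang2022LandauSiegel, §2 (2.6), (2.8)] -/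
theorem exp_049_le_and_t0_lt {D : ℕ} (hℓ : 3 ≤ ell D) :
    Real.exp (0.49 * ell D ^ 9) ≤ bigP D ^ (0.496 : ℝ) / 2 ∧
      t0 D ^ (1.02 : ℝ) < Real.exp (0.49 * ell D ^ 9) := by
  have hℓ0 : 0 < ell D := by linarith
  have hℓ1 : 1 ≤ ell D := by linarith
  have h9 := ell9_ge hℓ
  constructor
  · rw [bigP, ← Real.exp_mul]
    have h2 : (2 : ℝ) ≤ Real.exp 1 := by have := Real.add_one_le_exp (1 : ℝ); linarith
    rw [le_div_iff₀ (by norm_num : (0 : ℝ) < 2)]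
    calc Real.exp (0.49 * ell D ^ 9) * 2 ≤ Real.exp (0.49 * ell D ^ 9) * Real.exp 1 :=
          mul_le_mul_of_nonneg_left h2 (Real.exp_pos _).le
      _ = Real.exp (0.49 * ell D ^ 9 + 1) := by rw [Real.exp_add]
      _ ≤ Real.exp (ell D ^ 9 * 0.496) := Real.exp_le_exp.mpr (by nlinarith)
  · have ht0 : 1 ≤ t0 D := by rw [t0]; exact one_le_pow₀ hℓ1
    calc t0 D ^ (1.02 : ℝ) ≤ t0 D ^ (2 : ℝ) := Real.rpow_le_rpow_of_exponent_le ht0 (by norm_num)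
      _ = ell D ^ 1038 := by rw [Real.rpow_two, t0, ← pow_mul]
      _ ≤ Real.exp (1038 * ell D) := by exact_mod_cast pow_le_exp_mul hℓ0.le 1038
      _ < Real.exp (0.49 * ell D ^ 9) := Real.exp_lt_exp.mpr (by nlinarith)

/-- **`Δ` far out**: if the Lemma-5.3 (ii) clause holds at `D` with constant `C` (`𝓛 ≥ 3`), then for
`y ≥ e^{0.49𝓛⁹}`: `|Δ(y)| ≤ 2C·e^{−𝓛¹⁰}·e^{−8𝓛⁹}·y⁻⁴` (both Gaussian-type terms of (5.9) are below
`e^{−𝓛¹⁰−4log y−8𝓛⁹}`: `termA`, `termB`). [cite: Zhang2022LandauSiegel, §5 Lemma 5.3 (5.9)] -/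
theorem norm_DeltaW_le_far {D : ℕ} (hℓ : 3 ≤ ell D) {C : ℝ} (hC : 0 ≤ C)
    (h53 : ∀ x : ℝ, 0 < x → t0 D ^ (1.02 : ℝ) < x →
      ‖DeltaW D x‖ ≤ C * (Real.exp (-((1 : ℝ) / 100 * ell2 D * Real.log x) ^ 2) +
        Real.exp (-(x ^ (0.99 : ℝ)) / ell2 D)))
    {y : ℝ} (hy : Real.exp (0.49 * ell D ^ 9) ≤ y) :
    ‖DeltaW D y‖ ≤ 2 * C * (Real.exp (-(ell D ^ 10)) * Real.exp (-(8 * ell D ^ 9)) * (y ^ 4)⁻¹) := by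
  have hℓ0 : 0 < ell D := by linarith
  have hy0 : 0 < y := lt_of_lt_of_le (Real.exp_pos _) hy
  have hy1 : 1 ≤ y := le_trans (Real.one_le_exp (by positivity)) hy
  have ht0 := (exp_049_le_and_t0_lt hℓ).2
  have hclause := h53 y hy0 (ht0.trans_le hy)
  have hlogy : 0.49 * ell D ^ 9 ≤ Real.log y := by
    have := Real.log_le_log (Real.exp_pos _) hy
    rwa [Real.log_exp] at this
  -- the common target `e^{−(𝓛¹⁰ + 4 log y + 8𝓛⁹)} = e^{−𝓛¹⁰} e^{−8𝓛⁹} y⁻⁴`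
  have hE : Real.exp (-(ell D ^ 10 + 4 * Real.log y + 8 * ell D ^ 9)) =
      Real.exp (-(ell D ^ 10)) * Real.exp (-(8 * ell D ^ 9)) * (y ^ 4)⁻¹ := by
    have h4 : Real.exp (4 * Real.log y) = y ^ 4 := by
      rw [show (4 : ℝ) * Real.log y = ((4 : ℕ) : ℝ) * Real.log y by norm_num, Real.exp_nat_mul,
        Real.exp_log hy0]
    rw [show -(ell D ^ 10 + 4 * Real.log y + 8 * ell D ^ 9) =
        -(ell D ^ 10) + -(8 * ell D ^ 9) + -(4 * Real.log y) by ring,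
      Real.exp_add, Real.exp_add, Real.exp_neg (4 * Real.log y), h4]
  have hA : Real.exp (-((1 : ℝ) / 100 * ell2 D * Real.log y) ^ 2) ≤
      Real.exp (-(ell D ^ 10 + 4 * Real.log y + 8 * ell D ^ 9)) := by
    rw [Real.exp_le_exp, neg_le_neg_iff, ell2]
    exact termA hℓ hlogy
  have hB : Real.exp (-(y ^ (0.99 : ℝ)) / ell2 D) ≤
      Real.exp (-(ell D ^ 10 + 4 * Real.log y + 8 * ell D ^ 9)) := by
    rw [Real.exp_le_exp, ell2]
    have hsq : Real.sqrt y ≤ y ^ (0.99 : ℝ) := by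
      rw [Real.sqrt_eq_rpow]; exact Real.rpow_le_rpow_of_exponent_le hy1 (by norm_num)
    have h2 := termB hℓ hy
    have hpos : 0 < ell D ^ 400 := by positivity
    rw [le_div_iff₀ hpos] at h2
    rw [neg_div, neg_le_neg_iff, le_div_iff₀ hpos]
    exact h2.trans hsq
  calc ‖DeltaW D y‖ ≤ _ := hclause
    _ ≤ C * (Real.exp (-(ell D ^ 10 + 4 * Real.log y + 8 * ell D ^ 9)) +
          Real.exp (-(ell D ^ 10 + 4 * Real.log y + 8 * ell D ^ 9))) :=
        mul_le_mul_of_nonneg_left (add_le_add hA hB) hC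
    _ = _ := by rw [hE]; ring

/-! ### `(κ∗𝐚₁)(m)` -/

/-- **`|(κ∗𝐚₁)(m)| ≤ B·τ(m)⁴`** when `|𝐚₁| ≤ B` (`|κ(k)| ≤ τ(k)³ ≤ τ(m)³` for `k ∣ m`).
[cite: Zhang2022LandauSiegel, §7 p.32] -/
theorem norm_conv_kappa_le (c' : ℝ) (D : ℕ) {a : ℕ → ℂ} {B : ℝ} (ha : ∀ n, ‖a n‖ ≤ B) (m : ℕ) :
    ‖MeanSquareMajorant.conv (kappaZ c' D) a m‖ ≤ B * (m.divisors.card : ℝ) ^ 4 := by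
  have hB : 0 ≤ B := le_trans (norm_nonneg _) (ha 0)
  refine (MeanSquareMajorant.norm_conv_le ha m).trans (mul_le_mul_of_nonneg_left ?_ hB)
  rw [MeanSquareMajorant.absDivSum_apply]
  rcases Nat.eq_zero_or_pos m with rfl | hm
  · simp
  have hτ : ∀ k ∈ m.divisors, ‖kappaZ c' D k‖ ≤ (m.divisors.card : ℝ) ^ 3 := by
    intro k hk
    have hk0 : k ≠ 0 := Nat.ne_of_gt (Nat.pos_of_mem_divisors hk)
    have hsub : k.divisors ⊆ m.divisors :=
      Nat.divisors_subset_of_dvd hm.ne' (Nat.dvd_of_mem_divisors hk)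
    have hcard : (k.divisors.card : ℝ) ≤ m.divisors.card := by
      exact_mod_cast Finset.card_le_card hsub
    exact (XiZeroMajorants.norm_kappa_le_card_divisors_pow _ _ _ k hk0).trans
      (pow_le_pow_left₀ (by positivity) hcard 3)
  calc ∑ k ∈ m.divisors, ‖kappaZ c' D k‖ ≤ ∑ k ∈ m.divisors, (m.divisors.card : ℝ) ^ 3 :=
        Finset.sum_le_sum hτ
    _ = (m.divisors.card : ℝ) * (m.divisors.card : ℝ) ^ 3 := by
        rw [Finset.sum_const, nsmul_eq_mul]
    _ = (m.divisors.card : ℝ) ^ 4 := by ring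

/-- The prime window has at most `3P` members (`p ∼ P ⇒ p ≤ 2P`, `P ≥ 2`).
[cite: Zhang2022LandauSiegel, §2 p.4] -/
theorem card_primeWindow_le {D : ℕ} (hℓ : 1 ≤ ell D) :
    ((primeWindow D).card : ℝ) ≤ 3 * bigP D := by
  have hP2 : 2 ≤ bigP D := by
    rw [bigP]
    have h1 : (1 : ℝ) ≤ ell D ^ 9 := one_le_pow₀ hℓ
    have := Real.add_one_le_exp (ell D ^ 9)
    linarith
  have hsub : primeWindow D ⊆ Finset.range (⌈2 * bigP D⌉₊ + 1) := by
    intro p hp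
    have h2 := le_two_mul_bigP_of_mem_primeWindow hℓ hp
    have h3 : (p : ℝ) ≤ (⌈2 * bigP D⌉₊ : ℝ) := h2.trans (Nat.le_ceil _)
    have h4 : p ≤ ⌈2 * bigP D⌉₊ := by exact_mod_cast h3
    rw [Finset.mem_range]; omega
  calc ((primeWindow D).card : ℝ) ≤ ((Finset.range (⌈2 * bigP D⌉₊ + 1)).card : ℝ) := by
        exact_mod_cast Finset.card_le_card hsub
    _ = (⌈2 * bigP D⌉₊ : ℝ) + 1 := by rw [Finset.card_range]; push_cast; ring
    _ ≤ 2 * bigP D + 1 + 1 := by linarith [Nat.ceil_lt_add_one (show 0 ≤ 2 * bigP D by positivity)]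
    _ ≤ 3 * bigP D := by linarith

end Literature.NumberTheory.LFunctions.Zhang2022.Section7TailP2
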